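import Summits.BirchSwinnertonDyer.BirchSwinnertonDyer.Theorems.ManinLocalTwoThreeSixteenSplitCore
import Summits.BirchSwinnertonDyer.BirchSwinnertonDyer.Theorems.ManinLocalTwoThreeKummerCoverSubgroupTwo
import Summits.BirchSwinnertonDyer.BirchSwinnertonDyer.Theorems.ManinLocalTwoThreeKummerSquareCharacterEndgame
import Summits.BirchSwinnertonDyer.BirchSwinnertonDyer.Theorems.ManinLocalTwoThreeStevensCurveOfCuspZero
import HarnessLib

/-!
# C2 skeleton v24's COMPOSITION: the cusp-zero split — on `{∞,0}_f ∈ Λ₀(f)` (⊇ root number `−1`) the ℓ = 2 UDC congruence law closes C2, on the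
# complement the three v23 laws are consumed WITH THE EXTRA BINDER `{∞,0}_f ∉ Λ₀(f)` (analytic rank `0`, cuspidal point of even order)
(route `ManinLocalTwoThree`, deciding crux C2 `ManinOddAtFour` stmt-BirchSwinnertonDyer-22967; cell bsd-f2-manin, C2/C3 LEAD p1 gen 18;
`--supports stmt-BirchSwinnertonDyer-22967`; LEAD-MEMO v35 §3; sequel to `…SixteenSplitCore` (v20–v23 composition), `…StevensCurveOfCuspZero` (p745958),
`…KummerSquareCharacterEndgame` (p746256), p2 g19's `…KummerCoverSubgroupTwo` (NC₂-a + Kurth–Long glue))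

THE RECUT.  v23 reads C2 on the core at `16 ∣ N` from F♯, F★, CES, F-es-21♭K and three OPEN laws 6a‴/6b‴/6♭‴.  Here the datum-level composition
`…SixteenSplitCore.not_two_dvd_maninConstant_of_levelLaws_blindGuard_core` is re-run with a CASE SPLIT on the cusp `0`:
* LOCUS A `{∞,0}_f ∈ Λ₀(f)`: `Λ₁(f) = Λ₀(f)` (LEAD p745958, mod F★ ∧ F♮ ∧ CES).  Irreducible `W[2]`: F♯ (unchanged road).  Reducible: a rational `2`-torsion
  abscissa `e` lifts to a half-period `a` (S6₂); IF `2 ∣ c`, the NEW STUB **UDC₂** («`2 ∣ c` ⟹ the ℓ = 2 Kummer cover of `T` is CONGRUENCE»: `V_a` periodic under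
  `c{∞,γ∞}_f` for all `γ ∈ Γ₀(N) ∩ Γ(M)`, some `M ≥ 1` — the conjunction BI₂ ∧ AN₂ ∧ CDT of the ℓ = 2 UDC chain, p2 g19 / T-p1-g18-1) gives, by p2's
  `UDCTwo.sigmaSqRoot_gamma1_periodic_of_congruence` (Kurth–Long, a tree theorem) and the LEAD's endgame `periodLatticeGamma1_ne_of_sigmaSqRoot_gamma1_periodic`,
  `Λ₁ ≠ Λ₀` — contradiction.  So `2 ∤ c` on A from PRINT ∪ {F♯, UDC₂}.
* LOCUS B `{∞,0}_f ∉ Λ₀(f)`: v23's by-locus proof VERBATIM, every law instance now carrying the binder `{∞,0}_f ∉ Λ₀(f)` of the SAME newform (the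
  `a₁ = a₃ = 0` model and Stevens' curve share `f`), i.e. the laws 6a‴|_B, 6b‴|_B, 6♭‴|_B are STRICTLY WEAKER than v23's.
THEOREMS: `not_two_dvd_maninConstant_of_levelLawsB_udcTwo_core` (datum level, `4 ∣ N`), `maninOddAtSixteenCore_of_v24`, and
**`maninOddAtFour_of_katoFact_udcTwo_levelSixteenCoreLawsB`** = the route decl `ManinOddAtFour` BY NAME from: F♯, F★, F♮, CES, F-es-21♭K (printed),
UDC₂ (open, the ℓ = 2 line p2/p3 are building), 6a‴|_B, 6b‴|_B, 6♭‴|_B (open, weaker than v23's).  CONDITIONAL reduction; C2, Manin's conjecture and BSD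
are NOT proved.  No definitions, no sorry.
[cite: Kato2004Asterisque, Thm. 12.5 (1) (p. 221)] [cite: ConradEdixhovenStein2003, §6.1.2 and §6.2] [cite: Stevens1982, Thm. 1.3.1] [cite: Stevens1989, §2]
[cite: KurthLong2008, Prop. 18] [cite: CalegariDimitrovTang2025, Thm. 1.0.1 (the engine behind UDC₂; not used here)]
-/

set_option autoImplicit false
-- lint-debt: the directory name repeats the summit name (sibling precedent `ManinLocalTwoThreeSixteenSplitCore.lean`)
set_option linter.dupNamespace false

noncomputable section

open scoped Classical MatrixGroups ModularForm NumberField PeriodPair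
open PowerSeries CongruenceSubgroup IsDedekindDomain IsDedekindDomain.HeightOneSpectrum Rat.HeightOneSpectrum
open WeierstrassCurve Literature.NumberTheory.DiophantineGeometry Literature.NumberTheory.EllipticCurves
  Literature.NumberTheory.EllipticCurves.ModularForms Literature.RingTheory.FormalGroups
open Summit.BirchSwinnertonDyer.Rank1Residual.ManinAdditive
open Summit.BirchSwinnertonDyer.Rank1Residual.ManinAdditive.CuspidalKummer
open Summit.BirchSwinnertonDyer.Rank1Residual.ManinAdditive.ShimuraLedger
open Summit.BirchSwinnertonDyer.Rank1Residual.ManinAdditive.KatoCurve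
open Summit.BirchSwinnertonDyer.BirchSwinnertonDyer.Theorems.ManinLocalTwoThree.SigmaSquareRoot
open Summit.BirchSwinnertonDyer.BirchSwinnertonDyer.Theorems.ManinLocalTwoThree.SigmaHabitat

namespace Summit.BirchSwinnertonDyer.BirchSwinnertonDyer.Theorems.ManinLocalTwoThree.RootNumberSplit

/-! ## §1 The datum-level composition with the cusp-zero split -/

/-- **C2 LEVEL-WISE on the core, cusp-zero split** (`4 ∣ N`): locus A by F♯ / UDC₂ + Kurth–Long + the ℓ = 2 endgame + Θ; locus B by the v23 roads with the
laws restricted to `{∞,0}_f ∉ Λ₀(f)`.  CONDITIONAL reduction; nothing about BSD or Manin's conjecture is proved.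
[cite: Kato2004Asterisque, Thm. 12.5 (1) (p. 221)] [cite: ConradEdixhovenStein2003, §6.1.2] [cite: Stevens1982, Thm. 1.3.1] [cite: KurthLong2008, Prop. 18] -/
theorem not_two_dvd_maninConstant_of_levelLawsB_udcTwo_core
    (hF : kato_neron_isIntegral_twistedSymbolSum_of_additive_two_real)
    (hFstar : optimalGamma1Parametrization_cusp_rational) (hFnat : optimalGamma1Parametrization_cuspZero_galoisConjugate)
    (hex : exists_optimal_gamma1ParametrizationData)
    {N : ℕ} [NeZero N] (h4 : 2 ^ 2 ∣ N)
    (hUDC : ∀ (V : WeierstrassCurve ℚ) [V.IsElliptic] [V.IsGloballyMinimal] (D : ModularParametrizationData V N),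
      (∀ z ∈ D.L.lattice, ∃ w ∈ periodLattice D.f, z = D.c * w) → V.a₁ = 0 → V.a₃ = 0 →
      ∀ e : ℚ, V.twoTorsionPolynomial.toPoly.IsRoot e →
      ∀ (a : ℂ) (m₁ m₂ : ℤ), a ∉ D.L.lattice → 2 * a = m₁ * D.L.ω₁ + m₂ * D.L.ω₂ → ℘[D.L] a = (e : ℂ) + (V.b₂ : ℂ) / 12 →
      (2 : ℤ) ∣ D.c →
      ∃ M : ℕ, 0 < M ∧ ∀ γ : Gamma0 N, (γ : SL(2, ℤ)) ∈ CongruenceSubgroup.Gamma M → ∀ w : ℂ,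
        sigmaSqRoot D.L a (m₁ * D.L.η₁ + m₂ * D.L.η₂) (w + (D.c : ℂ) * cuspSymbol D.f γ) =
          sigmaSqRoot D.L a (m₁ * D.L.η₁ + m₂ * D.L.η₂) w)
    (h48N : ∀ (V : WeierstrassCurve ℚ) [V.IsElliptic] [V.IsGloballyMinimal] (D : ModularParametrizationData V N)
      (a : ℕ → ℤ), (∀ n, (a n : ℂ) = cuspCoeff D.f n) →
      (∀ z ∈ D.L.lattice, ∃ w ∈ periodLattice D.f, z = D.c * w) →
      ((primesEquiv (R := 𝓞 ℚ)).symm ⟨2, Nat.prime_two⟩).valuation ℚ V.j < 1 → (∀ d : ℤ, d = -1 ∨ d = 2 ∨ d = -2 → 2 ≤ (V.quadraticTwist (d : ℚ)).conductorExponent ((primesEquiv (R := ℤ)).symm ⟨2, Nat.prime_two⟩)) →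
      modularSymbol D.f 0 ∉ periodLattice D.f →
      ∀ e : ℚ, V.twoTorsionPolynomial.toPoly.IsRoot e → ∀ z : ℚ⟦X⟧, IsParamGerm V D.c a z →
      ∃ (r : ℕ → ℤ) (g A B : ℤ⟦X⟧), IsCuspidalKummerRep N (kummerSeries V D.c e z) r g A B)
    (h53N : ∀ (V : WeierstrassCurve ℚ) [V.IsElliptic] [V.IsGloballyMinimal] (D : ModularParametrizationData V N)
      (a : ℕ → ℤ), (∀ n, (a n : ℂ) = cuspCoeff D.f n) →
      (∀ z ∈ D.L.lattice, ∃ w ∈ periodLattice D.f, z = D.c * w) →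
      ((primesEquiv (R := 𝓞 ℚ)).symm ⟨2, Nat.prime_two⟩).valuation ℚ V.j < 1 → (∀ d : ℤ, d = -1 ∨ d = 2 ∨ d = -2 → 2 ≤ (V.quadraticTwist (d : ℚ)).conductorExponent ((primesEquiv (R := ℤ)).symm ⟨2, Nat.prime_two⟩)) →
      modularSymbol D.f 0 ∉ periodLattice D.f →
      ∀ (a₂ a₄ e : ℤ), V.a₁ = 0 → V.a₃ = 0 → V.a₂ = a₂ → V.a₄ = a₄ →
      V.twoTorsionPolynomial.toPoly.IsRoot (e : ℚ) → ¬ KummerBlindAtTwo a₂ a₄ e →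
      ∀ z : ℚ⟦X⟧, IsParamGerm V D.c a z →
      ∀ (r : ℕ → ℤ) (g A B : ℤ⟦X⟧), IsCuspidalKummerRep N (kummerSeries V D.c ((e : ℚ)) z) r g A B →
      ∃ δ ∈ N.divisors, Odd (r δ))
    (hKatoN : ∀ (V : WeierstrassCurve ℚ) [V.IsElliptic] [V.IsGloballyMinimal] (D₁ : Gamma1ParametrizationData V N),
      D₁.IsOptimal → (∃ (W₀ : WeierstrassCurve ℚ) (_ : W₀.IsElliptic) (_ : W₀.IsGloballyMinimal) (D₀ : ModularParametrizationData W₀ N),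
        IsIsogenous V W₀ ∧ (∀ z ∈ D₀.L.lattice, ∃ w ∈ periodLattice D₀.f, z = D₀.c * w) ∧
        W₀.a₁ = 0 ∧ W₀.a₃ = 0 ∧ HasRationalTwoTorsion W₀ ∧ AllRationalTwoTorsionBlind W₀ ∧
        ((primesEquiv (R := 𝓞 ℚ)).symm ⟨2, Nat.prime_two⟩).valuation ℚ W₀.j < 1 ∧
        (∀ d : ℤ, d = -1 ∨ d = 2 ∨ d = -2 → 2 ≤ (W₀.quadraticTwist (d : ℚ)).conductorExponent ((primesEquiv (R := ℤ)).symm ⟨2, Nat.prime_two⟩)) ∧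
        modularSymbol D₀.f 0 ∉ periodLattice D₀.f) → KatoFactTwoAt V D₁.f)
    (W : WeierstrassCurve ℚ) [W.IsElliptic] [W.IsGloballyMinimal] (D : ModularParametrizationData W N)
    (hopt : ∀ z ∈ D.L.lattice, ∃ w ∈ periodLattice D.f, z = D.c * w)
    (hss : ((primesEquiv (R := 𝓞 ℚ)).symm ⟨2, Nat.prime_two⟩).valuation ℚ W.j < 1) (hcore : (∀ d : ℤ, d = -1 ∨ d = 2 ∨ d = -2 → 2 ≤ (W.quadraticTwist (d : ℚ)).conductorExponent ((primesEquiv (R := ℤ)).symm ⟨2, Nat.prime_two⟩))) :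
    ¬ (2 : ℤ) ∣ D.maninConstant := by
  by_cases hirr : W.HasIrreducibleModPGaloisRep 2
  · exact katoManinOddTwo_of_real_of_exists_gamma1 hF hex W D hopt h4 hirr
  have h4' : 4 ∣ N := by norm_num at h4; exact h4
  obtain ⟨h2, hN2⟩ := lFunction_two_eq_zero_of_four_dvd W D.isNewformOf h4'
  have hadd := hasAdditiveReductionAt_two_of_lFunction_two_eq_zero W h2 hN2
  obtain ⟨C, M, hu, hCW, hM1, hM3, hmin⟩ := exists_smul_eq_map_a₁_a₃_eq_zero_of_hasAdditiveReductionAt_two W hadd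
  haveI := hmin
  obtain ⟨D', hf, hc, hL, -⟩ := exists_modularParametrizationData_smul_of_u_eq_one W D C hu
  have hopt' : ∀ z ∈ D'.L.lattice, ∃ w ∈ periodLattice D'.f, z = D'.c * w := by
    rw [hL, hf, hc]; exact hopt
  have ha₁ : (C • W).a₁ = 0 := by rw [hCW, map_a₁, hM1, map_zero]
  have ha₃ : (C • W).a₃ = 0 := by rw [hCW, map_a₃, hM3, map_zero]
  have hssC : ((primesEquiv (R := 𝓞 ℚ)).symm ⟨2, Nat.prime_two⟩).valuation ℚ (C • W).j < 1 := by
    rw [variableChange_j]; exact hss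
  have hcoreC := twistCore_smul W C hcore
  suffices h : ¬ (2 : ℤ) ∣ D'.maninConstant by
    change ¬ (2 : ℤ) ∣ D'.c at h
    change ¬ (2 : ℤ) ∣ D.c
    rwa [hc] at h
  have hred' : ¬ (C • W).HasIrreducibleModPGaloisRep 2 := by
    rwa [Mazur1978.hasIrreducibleModPGaloisRep_smul_iff]
  by_cases h0 : modularSymbol D'.f 0 ∈ periodLattice D'.f
  · -- LOCUS A: `Λ₁ = Λ₀` (Θ at `m = 1`), a rational `2`-torsion point, and UDC₂ would force `Λ₁ ≠ Λ₀`
    have hΛ := periodLatticeGamma1_eq_of_modularSymbol_zero_mem_of_print hFstar hFnat hex D' hopt' h0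
    obtain ⟨e, he⟩ := exists_isRoot_twoTorsionPolynomial_of_not_hasIrreducibleModPGaloisRep_two (C • W) hred'
    obtain ⟨a, ha, h2aΛ, h℘⟩ := exists_halfPeriod_of_twoTorsion_root D' he
    obtain ⟨m₁, m₂, hm⟩ := PeriodPair.mem_lattice.mp h2aΛ
    intro h2
    obtain ⟨M₀, hM₀, hcong⟩ := hUDC (C • W) D' hopt' ha₁ ha₃ e he a m₁ m₂ ha hm.symm h℘ h2
    have hper := UDCTwo.sigmaSqRoot_gamma1_periodic_of_congruence D' hopt' ha hm.symm hM₀ hcong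
    exact periodLatticeGamma1_ne_of_sigmaSqRoot_gamma1_periodic D' hopt' ha hm.symm hper hΛ
  · -- LOCUS B: v23's roads with the binder `{∞,0}_f ∉ Λ₀(f)` threaded
    by_cases hnb : HasNonBlindRationalTwoTorsion (C • W)
    · exact not_two_dvd_maninConstant_of_cuspidalKummerAt_of_hasNonBlind (C • W) D' h4 ha₁ ha₃ hnb
        (fun a ha => h48N (C • W) D' a ha hopt' hssC hcoreC h0) (fun a ha => h53N (C • W) D' a ha hopt' hssC hcoreC h0)
    · have hall : AllRationalTwoTorsionBlind (C • W) := (allBlind_or_hasNonBlind (C • W)).resolve_right hnb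
      obtain ⟨e, he⟩ := exists_isRoot_twoTorsionPolynomial_of_not_hasIrreducibleModPGaloisRep_two (C • W) hred'
      have hT : HasRationalTwoTorsion (C • W) := ⟨e, (isRoot_twoTorsionPolynomial_iff_of_a₁_a₃ (C • W) ha₁ ha₃ e).mp he⟩
      obtain ⟨W₁, i₁, i₂, D₁, hiso, hD₁⟩ := hex (C • W) D' hopt'
      have hK : KatoFactTwoAt W₁ D₁.f :=
        hKatoN W₁ D₁ hD₁ ⟨C • W, inferInstance, hmin, D', hiso, hopt', ha₁, ha₃, hT, hall, hssC, hcoreC, h0⟩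
      exact not_two_dvd_maninConstant_of_katoFactAt₁_of_allBlind hFstar W₁ (C • W) D₁ D' hiso hD₁ hopt' h4 ha₁ ha₃ hall hK

/-! ## §2 The `16 ∣ N` core form and the route decl by name -/

/-- **C2 on the core ∩ {`16 ∣ N`} ⟸ F♯ ∧ F★ ∧ F♮ ∧ CES ∧ F-es-21♭K ∧ UDC₂ ∧ the three v23 laws RESTRICTED to `{∞,0}_f ∉ Λ₀(f)`** (§1 + the period-recut
dispatcher of `…ManinOddAtSixteenOfStubs`).  CONDITIONAL. [cite: Kato2004Asterisque, Thm. 12.5 (1) (p. 221)] [cite: Stevens1982, Thm. 1.3.1] [cite: KurthLong2008, Prop. 18] -/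
theorem maninOddAtSixteenCore_of_v24
    (hF : kato_neron_isIntegral_twistedSymbolSum_of_additive_two_real)
    (hFstar : optimalGamma1Parametrization_cusp_rational) (hFnat : optimalGamma1Parametrization_cuspZero_galoisConjugate)
    (hex : exists_optimal_gamma1ParametrizationData) (hK : kato_isIntegral_twistedSymbolSum_two_symbolClosure)
    (hUDC : ∀ (W : WeierstrassCurve ℚ) [W.IsElliptic] [W.IsGloballyMinimal] {N : ℕ} [NeZero N] (D : ModularParametrizationData W N),
      2 ^ 4 ∣ N → (∀ z ∈ D.L.lattice, ∃ w ∈ periodLattice D.f, z = D.c * w) → W.a₁ = 0 → W.a₃ = 0 →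
      ∀ e : ℚ, W.twoTorsionPolynomial.toPoly.IsRoot e →
      ∀ (a : ℂ) (m₁ m₂ : ℤ), a ∉ D.L.lattice → 2 * a = m₁ * D.L.ω₁ + m₂ * D.L.ω₂ → ℘[D.L] a = (e : ℂ) + (W.b₂ : ℂ) / 12 →
      (2 : ℤ) ∣ D.c →
      ∃ M : ℕ, 0 < M ∧ ∀ γ : Gamma0 N, (γ : SL(2, ℤ)) ∈ CongruenceSubgroup.Gamma M → ∀ w : ℂ,
        sigmaSqRoot D.L a (m₁ * D.L.η₁ + m₂ * D.L.η₂) (w + (D.c : ℂ) * cuspSymbol D.f γ) =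
          sigmaSqRoot D.L a (m₁ * D.L.η₁ + m₂ * D.L.η₂) w)
    (h48 : ∀ (W : WeierstrassCurve ℚ) [W.IsElliptic] [W.IsGloballyMinimal] {N : ℕ} [NeZero N]
      (D : ModularParametrizationData W N) (a : ℕ → ℤ), (∀ n, (a n : ℂ) = cuspCoeff D.f n) →
      2 ^ 4 ∣ N → (∀ z ∈ D.L.lattice, ∃ w ∈ periodLattice D.f, z = D.c * w) →
      ((primesEquiv (R := 𝓞 ℚ)).symm ⟨2, Nat.prime_two⟩).valuation ℚ W.j < 1 →
      (∀ d : ℤ, d = -1 ∨ d = 2 ∨ d = -2 → 2 ≤ (W.quadraticTwist (d : ℚ)).conductorExponent ((primesEquiv (R := ℤ)).symm ⟨2, Nat.prime_two⟩)) →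
      modularSymbol D.f 0 ∉ periodLattice D.f →
      ∀ e : ℚ, W.twoTorsionPolynomial.toPoly.IsRoot e →
      ∀ z : ℚ⟦X⟧, IsParamGerm W D.c a z →
      ∃ (r : ℕ → ℤ) (g A B : ℤ⟦X⟧), IsCuspidalKummerRep N (kummerSeries W D.c e z) r g A B)
    (h53 : ∀ (W : WeierstrassCurve ℚ) [W.IsElliptic] [W.IsGloballyMinimal] {N : ℕ} [NeZero N]
      (D : ModularParametrizationData W N) (a : ℕ → ℤ), (∀ n, (a n : ℂ) = cuspCoeff D.f n) →
      2 ^ 4 ∣ N → (∀ z ∈ D.L.lattice, ∃ w ∈ periodLattice D.f, z = D.c * w) →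
      ((primesEquiv (R := 𝓞 ℚ)).symm ⟨2, Nat.prime_two⟩).valuation ℚ W.j < 1 →
      (∀ d : ℤ, d = -1 ∨ d = 2 ∨ d = -2 → 2 ≤ (W.quadraticTwist (d : ℚ)).conductorExponent ((primesEquiv (R := ℤ)).symm ⟨2, Nat.prime_two⟩)) →
      modularSymbol D.f 0 ∉ periodLattice D.f →
      ∀ (a₂ a₄ e : ℤ), W.a₁ = 0 → W.a₃ = 0 → W.a₂ = a₂ → W.a₄ = a₄ →
      W.twoTorsionPolynomial.toPoly.IsRoot (e : ℚ) → ¬ KummerBlindAtTwo a₂ a₄ e →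
      ∀ z : ℚ⟦X⟧, IsParamGerm W D.c a z →
      ∀ (r : ℕ → ℤ) (g A B : ℤ⟦X⟧), IsCuspidalKummerRep N (kummerSeries W D.c ((e : ℚ)) z) r g A B →
      ∃ δ ∈ N.divisors, Odd (r δ))
    (h110 : ∀ (V : WeierstrassCurve ℚ) [V.IsElliptic] [V.IsGloballyMinimal] {N : ℕ} [NeZero N]
      (D₁ : Gamma1ParametrizationData V N), D₁.IsOptimal → 2 ^ 4 ∣ N →
      (¬ ∃ (V' : WeierstrassCurve ℚ) (_ : V'.IsElliptic) (_ : V'.IsGloballyMinimal) (q m : ℤ),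
        Odd q ∧ WeierstrassCurve.IsIsogenous V' V ∧ (q : ℝ) * V'.realPeriodRat = (m : ℝ) * V.realPeriodRat ∧
        IsSymbolClosureCurve V' D₁.f) →
      (∃ (W₀ : WeierstrassCurve ℚ) (_ : W₀.IsElliptic) (_ : W₀.IsGloballyMinimal) (D₀ : ModularParametrizationData W₀ N),
        IsIsogenous V W₀ ∧ (∀ z ∈ D₀.L.lattice, ∃ w ∈ periodLattice D₀.f, z = D₀.c * w) ∧
        W₀.a₁ = 0 ∧ W₀.a₃ = 0 ∧ HasRationalTwoTorsion W₀ ∧ AllRationalTwoTorsionBlind W₀ ∧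
        ((primesEquiv (R := 𝓞 ℚ)).symm ⟨2, Nat.prime_two⟩).valuation ℚ W₀.j < 1 ∧
        (∀ d : ℤ, d = -1 ∨ d = 2 ∨ d = -2 → 2 ≤ (W₀.quadraticTwist (d : ℚ)).conductorExponent ((primesEquiv (R := ℤ)).symm ⟨2, Nat.prime_two⟩)) ∧
        modularSymbol D₀.f 0 ∉ periodLattice D₀.f) →
      KatoFactTwoAt V D₁.f)
    :
    mazur_not_dvd_maninConstant_of_odd → abbesUllmo_not_dvd_maninConstant_of_not_dvd_level →
      cesnavicius_not_two_dvd_maninConstant_of_two_dvd_level → exists_isNewformOf →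
      ∀ (W : WeierstrassCurve ℚ) [W.IsElliptic] [W.IsGloballyMinimal] {N : ℕ} [NeZero N] (D : ModularParametrizationData W N),
        (∀ z ∈ D.L.lattice, ∃ w ∈ periodLattice D.f, z = D.c * w) → 2 ^ 4 ∣ N →
        ((primesEquiv (R := 𝓞 ℚ)).symm ⟨2, Nat.prime_two⟩).valuation ℚ W.j < 1 →
        (∀ d : ℤ, d = -1 ∨ d = 2 ∨ d = -2 → 2 ≤ (W.quadraticTwist (d : ℚ)).conductorExponent ((primesEquiv (R := ℤ)).symm ⟨2, Nat.prime_two⟩)) →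
        ¬ (2 : ℤ) ∣ D.maninConstant := by
  intro _hMz _hAU _hCs _hnf W _ _ N _ D hopt h16 hss hcore
  have h4 : 2 ^ 2 ∣ N := dvd_trans ⟨4, by norm_num⟩ h16
  exact not_two_dvd_maninConstant_of_levelLawsB_udcTwo_core hF hFstar hFnat hex h4
    (fun V _ _ D' hopt' ha₁ ha₃ e he a m₁ m₂ ha hm h℘ h2 => hUDC V D' h16 hopt' ha₁ ha₃ e he a m₁ m₂ ha hm h℘ h2)
    (fun V _ _ D' a ha hopt' hssV hcV h0 => h48 V D' a ha h16 hopt' hssV hcV h0)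
    (fun V _ _ D' a ha hopt' hssV hcV h0 => h53 V D' a ha h16 hopt' hssV hcV h0)
    (fun V _ _ D₁ hD₁ hguard =>
      katoFactTwoAt_of_symbolClosure_of_periodRecut hK h4 V D₁ (fun hno => h110 V D₁ hD₁ h16 hno hguard)) W D hopt hss hcore

/-- **THE ROUTE DECL `Theses.ManinLocalTwoThree.ManinOddAtFour` BY NAME from the inputs of skeleton v24** (§2, the binder-preserving rotation of
`…SixteenSplitCore` and p2's `maninOddAtFour_of_core`).  CONDITIONAL reduction; C2, Manin's conjecture and BSD are NOT proved.
[cite: Kato2004Asterisque, Thm. 12.5 (1) (p. 221)] [cite: ConradEdixhovenStein2003, §6.1.2 and §6.2] [cite: Stevens1982, Thm. 1.3.1] [cite: KurthLong2008, Prop. 18] -/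
theorem maninOddAtFour_of_katoFact_udcTwo_levelSixteenCoreLawsB
    (hF : kato_neron_isIntegral_twistedSymbolSum_of_additive_two_real)
    (hFstar : optimalGamma1Parametrization_cusp_rational) (hFnat : optimalGamma1Parametrization_cuspZero_galoisConjugate)
    (hex : exists_optimal_gamma1ParametrizationData) (hK : kato_isIntegral_twistedSymbolSum_two_symbolClosure)
    (hUDC : ∀ (W : WeierstrassCurve ℚ) [W.IsElliptic] [W.IsGloballyMinimal] {N : ℕ} [NeZero N] (D : ModularParametrizationData W N),
      2 ^ 4 ∣ N → (∀ z ∈ D.L.lattice, ∃ w ∈ periodLattice D.f, z = D.c * w) → W.a₁ = 0 → W.a₃ = 0 →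
      ∀ e : ℚ, W.twoTorsionPolynomial.toPoly.IsRoot e →
      ∀ (a : ℂ) (m₁ m₂ : ℤ), a ∉ D.L.lattice → 2 * a = m₁ * D.L.ω₁ + m₂ * D.L.ω₂ → ℘[D.L] a = (e : ℂ) + (W.b₂ : ℂ) / 12 →
      (2 : ℤ) ∣ D.c →
      ∃ M : ℕ, 0 < M ∧ ∀ γ : Gamma0 N, (γ : SL(2, ℤ)) ∈ CongruenceSubgroup.Gamma M → ∀ w : ℂ,
        sigmaSqRoot D.L a (m₁ * D.L.η₁ + m₂ * D.L.η₂) (w + (D.c : ℂ) * cuspSymbol D.f γ) =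
          sigmaSqRoot D.L a (m₁ * D.L.η₁ + m₂ * D.L.η₂) w)
    (h48 : ∀ (W : WeierstrassCurve ℚ) [W.IsElliptic] [W.IsGloballyMinimal] {N : ℕ} [NeZero N]
      (D : ModularParametrizationData W N) (a : ℕ → ℤ), (∀ n, (a n : ℂ) = cuspCoeff D.f n) →
      2 ^ 4 ∣ N → (∀ z ∈ D.L.lattice, ∃ w ∈ periodLattice D.f, z = D.c * w) →
      ((primesEquiv (R := 𝓞 ℚ)).symm ⟨2, Nat.prime_two⟩).valuation ℚ W.j < 1 →
      (∀ d : ℤ, d = -1 ∨ d = 2 ∨ d = -2 → 2 ≤ (W.quadraticTwist (d : ℚ)).conductorExponent ((primesEquiv (R := ℤ)).symm ⟨2, Nat.prime_two⟩)) →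
      modularSymbol D.f 0 ∉ periodLattice D.f →
      ∀ e : ℚ, W.twoTorsionPolynomial.toPoly.IsRoot e →
      ∀ z : ℚ⟦X⟧, IsParamGerm W D.c a z →
      ∃ (r : ℕ → ℤ) (g A B : ℤ⟦X⟧), IsCuspidalKummerRep N (kummerSeries W D.c e z) r g A B)
    (h53 : ∀ (W : WeierstrassCurve ℚ) [W.IsElliptic] [W.IsGloballyMinimal] {N : ℕ} [NeZero N]
      (D : ModularParametrizationData W N) (a : ℕ → ℤ), (∀ n, (a n : ℂ) = cuspCoeff D.f n) →
      2 ^ 4 ∣ N → (∀ z ∈ D.L.lattice, ∃ w ∈ periodLattice D.f, z = D.c * w) →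
      ((primesEquiv (R := 𝓞 ℚ)).symm ⟨2, Nat.prime_two⟩).valuation ℚ W.j < 1 →
      (∀ d : ℤ, d = -1 ∨ d = 2 ∨ d = -2 → 2 ≤ (W.quadraticTwist (d : ℚ)).conductorExponent ((primesEquiv (R := ℤ)).symm ⟨2, Nat.prime_two⟩)) →
      modularSymbol D.f 0 ∉ periodLattice D.f →
      ∀ (a₂ a₄ e : ℤ), W.a₁ = 0 → W.a₃ = 0 → W.a₂ = a₂ → W.a₄ = a₄ →
      W.twoTorsionPolynomial.toPoly.IsRoot (e : ℚ) → ¬ KummerBlindAtTwo a₂ a₄ e →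
      ∀ z : ℚ⟦X⟧, IsParamGerm W D.c a z →
      ∀ (r : ℕ → ℤ) (g A B : ℤ⟦X⟧), IsCuspidalKummerRep N (kummerSeries W D.c ((e : ℚ)) z) r g A B →
      ∃ δ ∈ N.divisors, Odd (r δ))
    (h110 : ∀ (V : WeierstrassCurve ℚ) [V.IsElliptic] [V.IsGloballyMinimal] {N : ℕ} [NeZero N]
      (D₁ : Gamma1ParametrizationData V N), D₁.IsOptimal → 2 ^ 4 ∣ N →
      (¬ ∃ (V' : WeierstrassCurve ℚ) (_ : V'.IsElliptic) (_ : V'.IsGloballyMinimal) (q m : ℤ),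
        Odd q ∧ WeierstrassCurve.IsIsogenous V' V ∧ (q : ℝ) * V'.realPeriodRat = (m : ℝ) * V.realPeriodRat ∧
        IsSymbolClosureCurve V' D₁.f) →
      (∃ (W₀ : WeierstrassCurve ℚ) (_ : W₀.IsElliptic) (_ : W₀.IsGloballyMinimal) (D₀ : ModularParametrizationData W₀ N),
        IsIsogenous V W₀ ∧ (∀ z ∈ D₀.L.lattice, ∃ w ∈ periodLattice D₀.f, z = D₀.c * w) ∧
        W₀.a₁ = 0 ∧ W₀.a₃ = 0 ∧ HasRationalTwoTorsion W₀ ∧ AllRationalTwoTorsionBlind W₀ ∧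
        ((primesEquiv (R := 𝓞 ℚ)).symm ⟨2, Nat.prime_two⟩).valuation ℚ W₀.j < 1 ∧
        (∀ d : ℤ, d = -1 ∨ d = 2 ∨ d = -2 → 2 ≤ (W₀.quadraticTwist (d : ℚ)).conductorExponent ((primesEquiv (R := ℤ)).symm ⟨2, Nat.prime_two⟩)) ∧
        modularSymbol D₀.f 0 ∉ periodLattice D₀.f) →
      KatoFactTwoAt V D₁.f)
    : Summit.BirchSwinnertonDyer.BirchSwinnertonDyer.Theses.ManinLocalTwoThree.ManinOddAtFour :=
  maninOddAtFour_of_core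
    (maninOddAtFourCore_of_maninOddAtSixteenCore
      (maninOddAtSixteenCore_of_v24 hF hFstar hFnat hex hK hUDC h48 h53 h110))

end Summit.BirchSwinnertonDyer.BirchSwinnertonDyer.Theorems.ManinLocalTwoThree.RootNumberSplit

end
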